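import Literature.AnabelianGeometry.AbsoluteAnabelian.MonoidKummerMaps
import Literature.AnabelianGeometry.AbsoluteAnabelian.MLFUnitsInfinitelyDivisible
import Literature.NumberTheory.GaloisRepresentations.LocalFieldFiniteExtensionIntegers
import HarnessLib

/-!
# [AbsTopIII] Remark 3.1.1 inside `k̄`: the units `𝒪_k̄^×` are the elements with `ℓ^n`-th roots in `k(x)`

Proof-only companion (theorems only, no new definitions) of
`Literature.AnabelianGeometry.AbsoluteAnabelian.MLFGaloisModel` / `MonoidKummerMaps` (abc-iut-L4-t2:
the model data of S. Mochizuki, *Topics in absolute anabelian geometry III*, Def 3.1 (i) p.66 —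
`MLFClosure` = an MLF `k` with an algebraic closure `K = k̄`; `integersClosure k K = 𝒪_k̄` := the
integral closure of `𝒪_k` in `k̄`; `unitSubmonoid k K = 𝒪_k̄^×` — and the named fact
`UnitsAreInfinitelyDivisibleElements` of Remark 3.1.1 p.70; bib key `MochizukiAbsTopIII2015`, lit
key `paper:url-5493eb38cbb7`).

MAIN THEOREM (`mem_unitSubmonoid_iff_exists_prime_forall_exists_pow_eq`, and its `MLFClosure`
form `MLFClosure.mem_unitSubmonoid_iff_exists_prime_forall_exists_pow_eq`): for an MLF `k` (any
non-archimedean local field), an algebraic extension `K` of `k` and `x ∈ K`, `x ≠ 0`,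

  `x ∈ 𝒪_K^×  ↔  ∃ ℓ prime, ∀ n, ∃ y ∈ k(x), y ^ (ℓ ^ n) = x`,

which is VERBATIM the body of the named fact `UnitsAreInfinitelyDivisibleElements` typed by
abc-iut-L4-t2 for [AbsTopIII] Remark 3.1.1 p.70 ("`𝒪_k̄^× ⊆ k̄^×` may be characterized as the
subgroup of elements divisible by arbitrary powers of some prime number", read — as the text says —
"by taking the invariants with respect to some open subgroup", i.e. at the finite levels `k(x)`;
verbatim in `k̄^×` every element is infinitely divisible).  That fact is DISCHARGED here:
`unitsAreInfinitelyDivisibleElements : UnitsAreInfinitelyDivisibleElements`.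

PROOF.  `k(x)/k` is finite, hence (tree, `LocalFieldFiniteExtension.lean`:
`FiniteExtension.isNonarchimedeanLocalField`) a non-archimedean local field for the prolonged
valuation, whose ring of integers is the integral closure of `𝒪_k` (tree,
`LocalFieldFiniteExtensionIntegers.lean`: `FiniteExtension.mem_integer_iff_isIntegral`); so
`x ∈ 𝒪_k̄^×` iff `x` is a unit of `𝒪_{k(x)}`, iff (the MLF-level Remark 3.1.1, tree
`MLFUnitsInfinitelyDivisible.lean`:
`IsNonarchimedeanLocalField.valuation_eq_one_iff_exists_prime_forall_exists_pow_eq`, Hensel +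
Krull) `x` has `ℓ^n`-th roots in `k(x)` for all `n`, for some prime `ℓ`.

Also recorded: `mem_integersClosure_iff_isIntegral`, `mem_unitSubmonoid_iff`
(`𝒪_k̄^× = {x ≠ 0 : x, x⁻¹ integral over 𝒪_k}`), `IntermediateField.isIntegral_coe_iff`
(integrality is insensitive to the finite level), `mem_unitSubmonoid_iff_valuation_adjoin_eq_one`
(`x ∈ 𝒪_k̄^× ↔ v_{k(x)}(x) = 1`).
HONEST FRAMING: OUR kernel check of a classical fact quoted by a refereed paper; it takes no side on
[IUTchIII] Cor 3.12.
-/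

noncomputable section

namespace Literature.AnabelianGeometry.AbsoluteAnabelian

open _root_.ValuativeRel
open Literature.NumberTheory.GaloisRepresentations

universe u

section General

variable (k : Type u) [Field k] [ValuativeRel k] (K : Type u) [Field K] [Algebra k K]

/-- Unfolding lemma: `x ∈ 𝒪_k̄` (`integersClosure k K`) iff `x` is integral over `𝒪_k`.
[cite: MochizukiAbsTopIII2015, Definition 3.1 (i) p.66] -/
theorem mem_integersClosure_iff_isIntegral {x : K} :
    x ∈ integersClosure k K ↔ IsIntegral 𝒪[k] x :=
  Iff.rfl

/-- Unfolding lemma: `x ∈ 𝒪_k̄^×` (`unitSubmonoid k K`) iff `x ≠ 0` and both `x` and `x⁻¹` are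
integral over `𝒪_k` (the inverse in `𝒪_k̄` of a unit is its inverse in the field `k̄`).
[cite: MochizukiAbsTopIII2015, Definition 3.1 (i) p.66] -/
theorem mem_unitSubmonoid_iff {x : K} :
    x ∈ unitSubmonoid k K ↔ x ≠ 0 ∧ IsIntegral 𝒪[k] x ∧ IsIntegral 𝒪[k] x⁻¹ := by
  constructor
  · rintro ⟨hx, y, hy, hxy⟩
    have hx0 : x ≠ 0 := by
      rintro rfl
      exact zero_ne_one ((zero_mul y).symm.trans hxy)
    have hyx : y = x⁻¹ := eq_inv_of_mul_eq_one_right hxy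
    subst hyx
    exact ⟨hx0, hx, hy⟩
  · rintro ⟨hx0, hx, hxi⟩
    exact ⟨hx, x⁻¹, hxi, mul_inv_cancel₀ hx0⟩

/-- Integrality over `𝒪_k` is insensitive to the finite level: for an intermediate field
`k ⊆ E ⊆ K` and `y ∈ E`, `y` is integral over `𝒪_k` as an element of `K` iff as an element of `E`
(so `𝒪_k̄ ∩ E` = the integral closure of `𝒪_k` in `E`, the "ring of integers of `E`" of Def 3.1 (i)
at the finite level `E`).
[cite: MochizukiAbsTopIII2015, Definition 3.1 (i) p.66] -/
theorem IntermediateField.isIntegral_coe_iff (E : IntermediateField k K) (y : E) :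
    IsIntegral 𝒪[k] (y : K) ↔ IsIntegral 𝒪[k] y :=
  isIntegral_algHom_iff (E.val.restrictScalars 𝒪[k]) Subtype.val_injective

variable [TopologicalSpace k] [IsNonarchimedeanLocalField k]

/-- For a non-archimedean local field `k`, an extension `K` and `x ∈ K` algebraic over `k`:
`x ∈ 𝒪_K^×` (i.e. `x ≠ 0` and `x`, `x⁻¹` integral over `𝒪_k`) iff `x` has valuation `1` in the
local field `k(x)` (tree: `FiniteExtension.valuativeRel k k(x)`, the prolonged valuation; `x` is
viewed in `k(x)` as `IntermediateField.AdjoinSimple.gen k x`).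
Ref: Serre, *Local Fields*, Ch. II §2, Prop. 3. [cite: SerreLocalFields1979, Ch. II §2 Prop. 3] -/
theorem mem_unitSubmonoid_iff_valuation_adjoin_eq_one {x : K} (hxk : IsIntegral k x) :
    haveI : FiniteDimensional k (IntermediateField.adjoin k ({x} : Set K)) :=
      IntermediateField.adjoin.finiteDimensional hxk
    letI := FiniteExtension.valuativeRel k (IntermediateField.adjoin k ({x} : Set K))
    x ∈ unitSubmonoid k K ↔
      valuation (IntermediateField.adjoin k ({x} : Set K))
        (IntermediateField.AdjoinSimple.gen k x) = 1 := by
  haveI : FiniteDimensional k (IntermediateField.adjoin k ({x} : Set K)) :=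
    IntermediateField.adjoin.finiteDimensional hxk
  letI := FiniteExtension.valuativeRel k (IntermediateField.adjoin k ({x} : Set K))
  rw [mem_unitSubmonoid_iff]
  rcases eq_or_ne x 0 with rfl | hx0
  · have h0 : IntermediateField.AdjoinSimple.gen k (0 : K) = 0 := Subtype.ext rfl
    simp [h0]
  have hx'0 : IntermediateField.AdjoinSimple.gen k x ≠ 0 := fun h =>
    hx0 (congrArg (fun z : IntermediateField.adjoin k ({x} : Set K) => (z : K)) h)
  rw [FiniteExtension.valuation_eq_one_iff_isIntegral_and_isIntegral_inv k
    (IntermediateField.adjoin k ({x} : Set K)) hx'0]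
  have h1 := IntermediateField.isIntegral_coe_iff k K (IntermediateField.adjoin k ({x} : Set K))
    (IntermediateField.AdjoinSimple.gen k x)
  have h2 := IntermediateField.isIntegral_coe_iff k K (IntermediateField.adjoin k ({x} : Set K))
    (IntermediateField.AdjoinSimple.gen k x)⁻¹
  constructor
  · rintro ⟨-, hi, hii⟩
    exact ⟨h1.mp hi, h2.mp hii⟩
  · rintro ⟨hi, hii⟩
    exact ⟨hx0, h1.mpr hi, h2.mpr hii⟩

/-- **[AbsTopIII] Remark 3.1.1 inside an algebraic extension** (general form): for a
non-archimedean local field `k`, an algebraic extension `K ⊇ k` and `x ∈ K`, `x ≠ 0`: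
`x ∈ 𝒪_K^×` iff, for some prime `ℓ`, `x` has `ℓ^n`-th roots IN THE FIELD `k(x)` for all `n`
("`𝒪^× ⊆ k̄^×` may be characterized as the subgroup of elements divisible by arbitrary powers of
some prime number" — at the finite level `k(x)`, which is again a local field).
[cite: MochizukiAbsTopIII2015, Remark 3.1.1 p.70] -/
theorem mem_unitSubmonoid_iff_exists_prime_forall_exists_pow_eq [Algebra.IsAlgebraic k K]
    {x : K} (hx : x ≠ 0) :
    x ∈ unitSubmonoid k K ↔ ∃ ℓ : ℕ, ℓ.Prime ∧ ∀ n : ℕ,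
      ∃ y : K, y ∈ IntermediateField.adjoin k ({x} : Set K) ∧ y ^ (ℓ ^ n) = x := by
  have hxk : IsIntegral k x := (Algebra.IsAlgebraic.isAlgebraic x).isIntegral
  haveI : FiniteDimensional k (IntermediateField.adjoin k ({x} : Set K)) :=
    IntermediateField.adjoin.finiteDimensional hxk
  letI := FiniteExtension.valuativeRel k (IntermediateField.adjoin k ({x} : Set K))
  letI := FiniteExtension.topologicalSpace k (IntermediateField.adjoin k ({x} : Set K))
  haveI := FiniteExtension.isNonarchimedeanLocalField k (IntermediateField.adjoin k ({x} : Set K))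
  have hx'0 : IntermediateField.AdjoinSimple.gen k x ≠ 0 := fun h =>
    hx (congrArg (fun z : IntermediateField.adjoin k ({x} : Set K) => (z : K)) h)
  rw [mem_unitSubmonoid_iff_valuation_adjoin_eq_one k K hxk,
    IsNonarchimedeanLocalField.valuation_eq_one_iff_exists_prime_forall_exists_pow_eq
      (IntermediateField.adjoin k ({x} : Set K)) hx'0]
  refine exists_congr fun ℓ => and_congr_right fun _ => forall_congr' fun n => ?_
  constructor
  · rintro ⟨y, hy⟩
    refine ⟨(y : K), y.2, ?_⟩
    have := congrArg (fun z : IntermediateField.adjoin k ({x} : Set K) => (z : K)) hy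
    simpa using this
  · rintro ⟨y, hyE, hy⟩
    exact ⟨⟨y, hyE⟩, Subtype.ext (by simpa using hy)⟩

end General

/-- **[AbsTopIII] Remark 3.1.1 for the model data `MLFClosure`** (an MLF `k` with an algebraic
closure `K = k̄`): for `x ∈ k̄`, `x ≠ 0`, `x ∈ 𝒪_k̄^×` iff for some prime `ℓ` it has `ℓ^n`-th roots
in `k(x)` for all `n` — verbatim the body of abc-iut-L4-t2's named fact
`UnitsAreInfinitelyDivisibleElements` (`MonoidKummerMaps.lean`, universe `0`), discharged below.
[cite: MochizukiAbsTopIII2015, Remark 3.1.1 p.70] -/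
theorem MLFClosure.mem_unitSubmonoid_iff_exists_prime_forall_exists_pow_eq (C : MLFClosure.{u})
    {x : C.K} (hx : x ≠ 0) :
    x ∈ unitSubmonoid C.k C.K ↔ ∃ ℓ : ℕ, ℓ.Prime ∧ ∀ n : ℕ,
      ∃ y : C.K, y ∈ IntermediateField.adjoin C.k ({x} : Set C.K) ∧ y ^ (ℓ ^ n) = x :=
  Literature.AnabelianGeometry.AbsoluteAnabelian.mem_unitSubmonoid_iff_exists_prime_forall_exists_pow_eq
    C.k C.K hx

/-- **[AbsTopIII] Remark 3.1.1, DISCHARGED**: abc-iut-L4-t2's named fact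
`UnitsAreInfinitelyDivisibleElements` (`MonoidKummerMaps.lean`) holds — for every MLF `k` with
algebraic closure `k̄` and every `x ∈ k̄`, `x ≠ 0`: `x ∈ 𝒪_k̄^×` iff for some prime `ℓ` it has
`ℓ^n`-th roots in `k(x)` for all `n`.
[cite: MochizukiAbsTopIII2015, Remark 3.1.1 p.70] -/
theorem unitsAreInfinitelyDivisibleElements : UnitsAreInfinitelyDivisibleElements :=
  fun C _ hx => C.mem_unitSubmonoid_iff_exists_prime_forall_exists_pow_eq hx

/-! ### Definition 3.1 (iv): the `G_k`-invariant units `𝒪_k^× = (𝒪_k̄^×)^{G_k}` -/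

section InvariantUnits

variable (k : Type u) [Field k] [ValuativeRel k] (K : Type u) [Field K] [Algebra k K]

/-- An element of `k` is integral over `𝒪_k` (inside any extension `K`) iff it lies in `𝒪_k`
(valuation rings are integrally closed).
Ref: Serre, *Local Fields*, Ch. II §2 (the ring `A` of `v` is integrally closed).
[cite: SerreLocalFields1979, Ch. II §2 Prop. 3] -/
theorem isIntegral_algebraMap_iff_mem_integer {u : k} :
    IsIntegral 𝒪[k] (algebraMap k K u) ↔ u ∈ 𝒪[k] := by
  rw [isIntegral_algebraMap_iff (algebraMap k K).injective, IsIntegrallyClosed.isIntegral_iff]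
  constructor
  · rintro ⟨y, rfl⟩
    exact y.2
  · intro hu
    exact ⟨⟨u, hu⟩, rfl⟩

/-- The image in `k̄` of a unit of `𝒪_k` (an element of valuation `1`) is a `G_k`-invariant unit of
`𝒪_k̄`: `𝒪_k^× ⊆ (𝒪_k̄^×)^{G_k}` ("the subgroup `𝒪_k^× = (𝒪_k̄^×)^{Π_k} ⊆ 𝒪_k̄^×` of
Galois-invariants").
[cite: MochizukiAbsTopIII2015, Definition 3.1 (iv) p.69] -/
theorem algebraMap_mem_invariantUnits {u : k} (hu : valuation k u = 1) :
    algebraMap k K u ∈ invariantUnits k K := by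
  have hu0 : u ≠ 0 := by
    rintro rfl
    simp at hu
  have huO : u ∈ 𝒪[k] := by rw [Valuation.mem_integer_iff, hu]
  have huO' : u⁻¹ ∈ 𝒪[k] := by rw [Valuation.mem_integer_iff, map_inv₀, hu, inv_one]
  refine ⟨(mem_unitSubmonoid_iff k K).mpr ⟨?_, ?_, ?_⟩, fun σ => ?_⟩
  · exact (map_ne_zero_iff _ (algebraMap k K).injective).mpr hu0
  · exact (isIntegral_algebraMap_iff_mem_integer k K).mpr huO
  · rw [← map_inv₀]
    exact (isIntegral_algebraMap_iff_mem_integer k K).mpr huO'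
  · rw [AlgEquiv.smul_def, AlgEquiv.commutes]

/-- **Def 3.1 (iv): `(𝒪_k̄^×)^{G_k} = 𝒪_k^×`.**  For an MLF `k` (any valued field of characteristic
zero) and an algebraic closure `K = k̄`: an element of `k̄` is a `G_k`-invariant unit of `𝒪_k̄` iff it
is (the image of) an element of `k` of valuation `1` — Galois descent (`k̄^{G_k} = k`, `k̄/k` being
Galois in characteristic zero) plus integral closedness of `𝒪_k`.  This identifies the argument
`𝒪_k^× = (𝒪_k̄^×)^{Π_k}` of the pre-log-shell of Def 3.1 (iv) with the units of `𝒪_k`.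
[cite: MochizukiAbsTopIII2015, Definition 3.1 (iv) p.69] -/
theorem mem_invariantUnits_iff [CharZero k] [IsAlgClosure k K] {x : K} :
    x ∈ invariantUnits k K ↔ ∃ u : k, valuation k u = 1 ∧ algebraMap k K u = x := by
  constructor
  · rintro ⟨hxu, hfix⟩
    have hx' : x ∈ (⊥ : IntermediateField k K) := by
      rw [InfiniteGalois.mem_bot_iff_fixed]
      intro σ
      simpa [AlgEquiv.smul_def] using hfix σ
    obtain ⟨u, rfl⟩ := IntermediateField.mem_bot.mp hx'
    obtain ⟨hx0, hxi, hxi'⟩ := (mem_unitSubmonoid_iff k K).mp hxu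
    refine ⟨u, ?_, rfl⟩
    have hu0 : u ≠ 0 := fun h => hx0 (by rw [h, map_zero])
    have huO : u ∈ 𝒪[k] := (isIntegral_algebraMap_iff_mem_integer k K).mp hxi
    have huO' : u⁻¹ ∈ 𝒪[k] := by
      rw [← map_inv₀] at hxi'
      exact (isIntegral_algebraMap_iff_mem_integer k K).mp hxi'
    rw [Valuation.mem_integer_iff] at huO huO'
    rw [map_inv₀] at huO'
    have hpos : 0 < valuation k u := (Valuation.pos_iff _).mpr hu0
    exact le_antisymm huO ((inv_le_one₀ hpos).mp huO')
  · rintro ⟨u, hu, rfl⟩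
    exact algebraMap_mem_invariantUnits k K hu

/-- `(𝒪_k̄^×)^{G_k} = 𝒪_k^×` as an equality of subsets of `k̄`: the `G_k`-invariant units are the image
of the valuation-`1` elements of `k`. [cite: MochizukiAbsTopIII2015, Definition 3.1 (iv) p.69] -/
theorem invariantUnits_eq_image [CharZero k] [IsAlgClosure k K] :
    invariantUnits k K = algebraMap k K '' {u : k | valuation k u = 1} := by
  ext x
  rw [mem_invariantUnits_iff]
  constructor
  · rintro ⟨u, hu, rfl⟩
    exact ⟨u, hu, rfl⟩
  · rintro ⟨u, hu, rfl⟩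
    exact ⟨u, hu, rfl⟩

end InvariantUnits

/-- **Def 3.1 (iv) for the model data `MLFClosure`**: the `G_k`-invariant units of `𝒪_k̄` are exactly
the images of the units of `𝒪_k`. [cite: MochizukiAbsTopIII2015, Definition 3.1 (iv) p.69] -/
theorem MLFClosure.mem_invariantUnits_iff (C : MLFClosure.{u}) {x : C.K} :
    x ∈ invariantUnits C.k C.K ↔ ∃ u : C.k, valuation C.k u = 1 ∧ algebraMap C.k C.K u = x :=
  Literature.AnabelianGeometry.AbsoluteAnabelian.mem_invariantUnits_iff C.k C.K

end Literature.AnabelianGeometry.AbsoluteAnabelian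

end
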